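import Summits.PneNP.PneNP.Theorems.OneSliceConstantBandTransferStepAux
import Literature.Computability.Complexity.RossmanMonotoneCliqueGraphs
import Literature.Computability.Complexity.CliqueThresholdBounds
import Summits.PneNP.PneNP.Theorems.OneSliceConstantBandNearCliqueContiguityCount

/-!
# Near-clique contiguity on a critical slice (S2 of the line `flat-prior-relative-minterms`), part 2: patterns

The admissible pairs `(A, e)` (`A` a `k`-set, `e ∈ K_A`), the pattern "`K_A − e ⊆ on(y)`, `e ∉ on(y)`", the
near-clique count `X(y) = #{(A,e) : pattern}` on a slice, its first moment
`Σ_y X(y) = C(n,k)·C(k,2)·C(N-K, m-K+1)`, the second moment as a pair sum, and the three kinds of pairs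
(same clique, far `|A ∩ B| ≤ 1`, near `2 ≤ |A ∩ B| ≤ k-1`) with their counts. [folklore]
-/

noncomputable section
namespace Summit.PneNP.PneNP.Cruxes.ConstantBand.FlatPriorRelativeMinterms

set_option linter.dupNamespace false

open Literature.Computability.Complexity Filter Classical
open Finset hiding slice
open Summit.PneNP.PneNP.Theorems.ConstantBand.Negative

section Moment

set_option quotPrecheck false

variable {n : ℕ}

/-- The `k`-subsets of the vertex set. -/
local notation "𝒜⟦" n ", " k "⟧" => powersetCard k (univ : Finset (Fin n))

/-- The admissible pairs `(A, e)`: a `k`-set `A` and an edge `e` of `K_A`. -/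
local notation "𝒫⟦" n ", " k "⟧" =>
  Finset.filter (fun ae : Finset (Fin n) × Edge n => ae.2 ∈ edgesIn ae.1)
    ((powersetCard k (univ : Finset (Fin n))) ×ˢ (univ : Finset (Edge n)))

/-- The pattern of `(A, e)` in `y`: `K_A − e ⊆ on(y)` and `e ∉ on(y)`. -/
local notation "Pat⟦" A ", " e ", " y "⟧" =>
  ((∀ e' ∈ edgesIn A, e' ≠ e → y e' = true) ∧ y e = false)

/-- The near-clique count `X(y) = #{(A,e) : K_A − e ⊆ on(y), e ∉ on(y)}`. -/
local notation "Xc⟦" n ", " k ", " y "⟧" =>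
  Finset.card (Finset.filter (fun ae : Finset (Fin n) × Edge n => Pat⟦ae.1, ae.2, y⟧) 𝒫⟦n, k⟧)

/-- Cardinality of a filtered product, fibrewise over the first factor. [folklore] -/
theorem ncc_card_filter_product {α β : Type*} (s : Finset α) (t : Finset β) (p : α × β → Prop)
    [DecidablePred p] :
    #((s ×ˢ t).filter p) = ∑ a ∈ s, #(t.filter fun b => p (a, b)) := by
  rw [card_filter, sum_product]
  refine sum_congr rfl fun a _ => ?_
  rw [card_filter]

/-- Sums over the admissible pairs `(A, e)`, `e ∈ K_A`, fibrewise. [folklore] -/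
theorem ncc_sum_pairs {M : Type*} [AddCommMonoid M] (k : ℕ) (g : Finset (Fin n) × Edge n → M) :
    ∑ ae ∈ 𝒫⟦n, k⟧, g ae = ∑ A ∈ 𝒜⟦n, k⟧, ∑ e ∈ edgesIn A, g (A, e) := by
  rw [sum_filter, sum_product]
  refine sum_congr rfl fun A _ => ?_
  rw [← sum_filter]
  congr 1
  ext e
  simp

/-- In a `k`-set family, `#K_B = C(k,2)`. [folklore] -/
theorem ncc_card_edgesIn_of_mem {k : ℕ} {B : Finset (Fin n)} (hB : B ∈ 𝒜⟦n, k⟧) :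
    #(edgesIn B) = k.choose 2 := by
  rw [ncc_edgesIn_eq_filter, card_filter_cliqueVec, (mem_powersetCard.1 hB).2]

/-- `#𝒫 = C(n,k)·C(k,2)`. [folklore] -/
theorem ncc_card_pairs (k : ℕ) : #𝒫⟦n, k⟧ = n.choose k * k.choose 2 := by
  rw [card_eq_sum_ones, ncc_sum_pairs]
  have : ∀ A ∈ 𝒜⟦n, k⟧, ∑ _e ∈ edgesIn A, (1 : ℕ) = k.choose 2 := by
    intro A hA
    rw [sum_const, smul_eq_mul, mul_one, ncc_card_edgesIn_of_mem hA]
  rw [sum_congr rfl this, sum_const, smul_eq_mul, card_powersetCard, card_univ, Fintype.card_fin]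

/-- The pattern `(K_A − e) ⊆ on(y), e ∉ on(y)` in on/off form. [folklore] -/
theorem ncc_pat_iff (A : Finset (Fin n)) (e : Edge n) (y : Edge n → Bool) :
    Pat⟦A, e, y⟧ ↔
      (∀ e' ∈ (edgesIn A).erase e, y e' = true) ∧ ∀ e' ∈ ({e} : Finset (Edge n)), y e' = false := by
  simp only [mem_erase, mem_singleton, forall_eq, ne_eq, and_imp]
  exact ⟨fun h => ⟨fun e' hne he' => h.1 e' he' hne, h.2⟩, fun h => ⟨fun e' he' hne => h.1 e' hne he', h.2⟩⟩

/-- An admissible pair forces `C(k,2) ≥ 1`. [folklore] -/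
theorem ncc_one_le_K {k : ℕ} {A : Finset (Fin n)} {e : Edge n} (hA : A ∈ 𝒜⟦n, k⟧) (he : e ∈ edgesIn A) :
    1 ≤ k.choose 2 := by
  rw [← ncc_card_edgesIn_of_mem hA]
  exact card_pos.2 ⟨e, he⟩

/-- One pattern is matched by exactly `C(N-K, m-(K-1))` vectors of the slice `m`. [folklore] -/
theorem ncc_card_pat {k m : ℕ} {A : Finset (Fin n)} {e : Edge n} (hA : A ∈ 𝒜⟦n, k⟧)
    (he : e ∈ edgesIn A) (hm : k.choose 2 - 1 ≤ m) :
    #((slice n m).filter fun y => Pat⟦A, e, y⟧) =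
      (n.choose 2 - k.choose 2).choose (m - (k.choose 2 - 1)) := by
  have hK : #((edgesIn A).erase e) = k.choose 2 - 1 := by
    rw [card_erase_of_mem he, ncc_card_edgesIn_of_mem hA]
  have hdisj : Disjoint ((edgesIn A).erase e) {e} := by simp
  have h := ncc_card_slice_onoff (m := m) ((edgesIn A).erase e) {e} hdisj (by omega)
  rw [hK, card_singleton] at h
  have h1 := ncc_one_le_K hA he
  rw [show n.choose 2 - k.choose 2 = n.choose 2 - 1 - (k.choose 2 - 1) by omega, ← h]
  congr 1
  ext y
  simp only [mem_filter, ncc_pat_iff]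

/-- `Σ_y X(y) = Σ_{(A,e)} #{y : pattern}` (double counting). [folklore] -/
theorem ncc_sum_X_eq (k m : ℕ) :
    ∑ y ∈ slice n m, Xc⟦n, k, y⟧ = ∑ ae ∈ 𝒫⟦n, k⟧, #((slice n m).filter fun y => Pat⟦ae.1, ae.2, y⟧) := by
  calc ∑ y ∈ slice n m, Xc⟦n, k, y⟧
      = ∑ y ∈ slice n m, ∑ ae ∈ 𝒫⟦n, k⟧, (if Pat⟦ae.1, ae.2, y⟧ then 1 else 0) :=
        sum_congr rfl fun y _ => card_filter _ _
    _ = ∑ ae ∈ 𝒫⟦n, k⟧, ∑ y ∈ slice n m, (if Pat⟦ae.1, ae.2, y⟧ then 1 else 0) := sum_comm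
    _ = _ := sum_congr rfl fun ae _ => (card_filter _ _).symm

/-- **First moment**: `Σ_{y ∈ slice_m} X(y) = C(n,k)·C(k,2)·C(N-K, m-(K-1))`. [folklore] -/
theorem ncc_sum_X {k m : ℕ} (hm : k.choose 2 - 1 ≤ m) :
    ∑ y ∈ slice n m, Xc⟦n, k, y⟧ =
      n.choose k * k.choose 2 * (n.choose 2 - k.choose 2).choose (m - (k.choose 2 - 1)) := by
  rw [ncc_sum_X_eq]
  calc ∑ ae ∈ 𝒫⟦n, k⟧, #((slice n m).filter fun y => Pat⟦ae.1, ae.2, y⟧)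
      = ∑ _ae ∈ 𝒫⟦n, k⟧, (n.choose 2 - k.choose 2).choose (m - (k.choose 2 - 1)) := by
        refine sum_congr rfl fun ae hae => ?_
        obtain ⟨hae1, hae2⟩ := mem_filter.1 hae
        exact ncc_card_pat (mem_product.1 hae1).1 hae2 hm
    _ = _ := by rw [sum_const, smul_eq_mul, ncc_card_pairs]

/-- **Registered sub-goal of the Pairs file** (first moment of the near-clique count, `∀`-form of
`ncc_sum_X`, notation expanded). [folklore] -/
theorem ncc_pairs_firstMoment :
    ∀ n k m : ℕ, k.choose 2 - 1 ≤ m →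
      ∑ y ∈ slice n m, #(((powersetCard k (univ : Finset (Fin n)) ×ˢ (univ : Finset (Edge n))).filter
          fun ae => ae.2 ∈ edgesIn ae.1).filter
          fun ae => (∀ e' ∈ edgesIn ae.1, e' ≠ ae.2 → y e' = true) ∧ y ae.2 = false) =
        n.choose k * k.choose 2 * (n.choose 2 - k.choose 2).choose (m - (k.choose 2 - 1)) :=
  fun _ _ _ hm => ncc_sum_X hm

/-- **Second moment as a pair sum**: `Σ_y X(y)² = Σ_{(A,e)} Σ_{(B,e')} #{y : both patterns}`. [folklore] -/
theorem ncc_sum_X_sq (k m : ℕ) :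
    ∑ y ∈ slice n m, Xc⟦n, k, y⟧ ^ 2 =
      ∑ ae ∈ 𝒫⟦n, k⟧, ∑ be ∈ 𝒫⟦n, k⟧,
        #((slice n m).filter fun y => Pat⟦ae.1, ae.2, y⟧ ∧ Pat⟦be.1, be.2, y⟧) := by
  calc ∑ y ∈ slice n m, Xc⟦n, k, y⟧ ^ 2
      = ∑ y ∈ slice n m, ∑ ae ∈ 𝒫⟦n, k⟧, ∑ be ∈ 𝒫⟦n, k⟧,
          (if Pat⟦ae.1, ae.2, y⟧ ∧ Pat⟦be.1, be.2, y⟧ then 1 else 0) := by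
        refine sum_congr rfl fun y _ => ?_
        rw [sq, card_filter, sum_mul_sum]
        refine sum_congr rfl fun ae _ => sum_congr rfl fun be _ => ?_
        rw [ite_zero_mul_ite_zero, mul_one]
    _ = ∑ ae ∈ 𝒫⟦n, k⟧, ∑ be ∈ 𝒫⟦n, k⟧, ∑ y ∈ slice n m,
          (if Pat⟦ae.1, ae.2, y⟧ ∧ Pat⟦be.1, be.2, y⟧ then 1 else 0) := by
        rw [sum_comm]
        exact sum_congr rfl fun ae _ => sum_comm
    _ = _ := by
        refine sum_congr rfl fun ae _ => sum_congr rfl fun be _ => ?_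
        rw [card_filter]

/-- Two different edges of the same `K_A`: incompatible patterns. [folklore] -/
theorem ncc_pat_pat_same {m : ℕ} {A : Finset (Fin n)} {e e' : Edge n} (he' : e' ∈ edgesIn A)
    (hne : e' ≠ e) : ((slice n m).filter fun y => Pat⟦A, e, y⟧ ∧ Pat⟦A, e', y⟧) = ∅ := by
  refine filter_eq_empty_iff.2 fun y _ h => ?_
  have h1 : y e' = true := h.1.1 e' he' hne
  rw [h.2.2] at h1
  exact Bool.false_ne_true h1

/-- **Far pairs** (`|A ∩ B| ≤ 1`, edge-disjoint cliques): both patterns are matched by at most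
`C(N - 2K, m - (2K-2))` vectors of the slice. [folklore] -/
theorem ncc_card_pat_pat_far {k m : ℕ} {A B : Finset (Fin n)} {e e' : Edge n} (hA : A ∈ 𝒜⟦n, k⟧)
    (hB : B ∈ 𝒜⟦n, k⟧) (he : e ∈ edgesIn A) (he' : e' ∈ edgesIn B) (hAB : #(A ∩ B) ≤ 1) :
    #((slice n m).filter fun y => Pat⟦A, e, y⟧ ∧ Pat⟦B, e', y⟧) ≤
      (n.choose 2 - 2 * k.choose 2).choose (m - (2 * k.choose 2 - 2)) := by
  have hdis : ∀ f, f ∈ edgesIn A → f ∈ edgesIn B → False := fun f hfA hfB =>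
    absurd (ncc_two_le_card_inter hfA hfB) (by omega)
  have hee' : e ≠ e' := fun h => hdis e he (h ▸ he')
  set F := (edgesIn A).erase e ∪ (edgesIn B).erase e' with hF
  set G : Finset (Edge n) := {e, e'} with hG
  have hK1 : 1 ≤ k.choose 2 := ncc_one_le_K hA he
  have hcardF : #F = 2 * k.choose 2 - 2 := by
    rw [hF, card_union_of_disjoint, card_erase_of_mem he, card_erase_of_mem he',
      ncc_card_edgesIn_of_mem hA, ncc_card_edgesIn_of_mem hB]
    · omega
    · exact disjoint_left.2 fun f hf hf' => hdis f (mem_erase.1 hf).2 (mem_erase.1 hf').2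
  have hcardG : #G = 2 := by rw [hG, card_pair hee']
  have hFG : Disjoint F G := by
    rw [hF, hG, disjoint_left]
    intro f hf hfG
    rw [mem_insert, mem_singleton] at hfG
    rw [mem_union, mem_erase, mem_erase] at hf
    rcases hfG with rfl | rfl
    · rcases hf with ⟨hne, _⟩ | ⟨_, hfB⟩
      · exact hne rfl
      · exact hdis _ he hfB
    · rcases hf with ⟨_, hfA⟩ | ⟨hne, _⟩
      · exact hdis _ hfA he'
      · exact hne rfl
  calc #((slice n m).filter fun y => Pat⟦A, e, y⟧ ∧ Pat⟦B, e', y⟧)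
      ≤ #((slice n m).filter fun y => (∀ f ∈ F, y f = true) ∧ ∀ f ∈ G, y f = false) := by
        refine card_le_card fun y hy => ?_
        rw [mem_filter] at hy ⊢
        refine ⟨hy.1, fun f hf => ?_, fun f hf => ?_⟩
        · rw [hF, mem_union, mem_erase, mem_erase] at hf
          rcases hf with ⟨hne, hfA⟩ | ⟨hne, hfB⟩
          · exact hy.2.1.1 f hfA hne
          · exact hy.2.2.1 f hfB hne
        · rw [hG, mem_insert, mem_singleton] at hf
          rcases hf with rfl | rfl
          · exact hy.2.1.2
          · exact hy.2.2.2
    _ ≤ (n.choose 2 - #G - #F).choose (m - #F) := ncc_card_slice_onoff_le F G m hFG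
    _ = _ := by
        rw [hcardF, hcardG,
          show n.choose 2 - 2 - (2 * k.choose 2 - 2) = n.choose 2 - 2 * k.choose 2 by omega]

/-- **Near pairs** (any `A, B`): both patterns force `(K_A ∪ K_B) − {e,e'}` on, an edge set of size
`≥ 2K - C(|A∩B|,2) - 2`, so (hypergeometric tail) at most `p^{2K - C(|A∩B|,2) - 2}·#slice_m` vectors
match, whenever `m ≤ p·C(n,2)`, `p ≤ 1`. [folklore] -/
theorem ncc_card_pat_pat_near {k m : ℕ} {A B : Finset (Fin n)} (e e' : Edge n) (hA : A ∈ 𝒜⟦n, k⟧)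
    (hB : B ∈ 𝒜⟦n, k⟧) {p : ℝ} (hp0 : 0 ≤ p) (hp1 : p ≤ 1) (hmN : m ≤ n.choose 2)
    (hN : 0 < n.choose 2) (hmp : (m : ℝ) ≤ p * n.choose 2) :
    (#((slice n m).filter fun y => Pat⟦A, e, y⟧ ∧ Pat⟦B, e', y⟧) : ℝ) ≤
      p ^ (2 * k.choose 2 - (#(A ∩ B)).choose 2 - 2) * #(slice n m) := by
  set F := (edgesIn A ∪ edgesIn B) \ {e, e'} with hF
  have hcardF : 2 * k.choose 2 - (#(A ∩ B)).choose 2 - 2 ≤ #F := by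
    have h1 := le_card_sdiff {e, e'} (edgesIn A ∪ edgesIn B)
    rw [ncc_card_edgesIn_union, (mem_powersetCard.1 hA).2, (mem_powersetCard.1 hB).2] at h1
    have h2 : #({e, e'} : Finset (Edge n)) ≤ 2 :=
      (card_insert_le _ _).trans (by rw [card_singleton])
    rw [hF]
    omega
  have hsub : #((slice n m).filter fun y => Pat⟦A, e, y⟧ ∧ Pat⟦B, e', y⟧) ≤
      #((slice n m).filter fun y => ∀ f ∈ F, y f = true) := by
    refine card_le_card fun y hy => ?_
    rw [mem_filter] at hy ⊢
    refine ⟨hy.1, fun f hf => ?_⟩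
    rw [hF, Finset.mem_sdiff, mem_union, mem_insert, mem_singleton, not_or] at hf
    rcases hf.1 with hfA | hfB
    · exact hy.2.1.1 f hfA hf.2.1
    · exact hy.2.2.1 f hfB hf.2.2
  have hq : (m : ℝ) / n.choose 2 ≤ p := by
    rw [div_le_iff₀ (by exact_mod_cast hN)]
    exact hmp
  calc (#((slice n m).filter fun y => Pat⟦A, e, y⟧ ∧ Pat⟦B, e', y⟧) : ℝ)
      ≤ #((slice n m).filter fun y => ∀ f ∈ F, y f = true) := by exact_mod_cast hsub
    _ ≤ ((m : ℝ) / n.choose 2) ^ #F * #(slice n m) := by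
        have h := ts_card_slice_filter_supset_mul_le F hmN
        have hN' : (0 : ℝ) < (n.choose 2 : ℝ) ^ #F := by positivity
        rw [div_pow, div_mul_eq_mul_div, le_div_iff₀ hN']
        exact_mod_cast h
    _ ≤ p ^ #F * #(slice n m) := by gcongr
    _ ≤ p ^ (2 * k.choose 2 - (#(A ∩ B)).choose 2 - 2) * #(slice n m) := by
        gcongr ?_ * _
        exact pow_le_pow_of_le_one hp0 hp1 hcardF

/-- `k`-sets meeting a fixed `k`-set `A` in exactly `a` vertices: at most `C(k,a)·C(n-k,k-a)` of them.
[folklore] -/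
theorem ncc_card_fibre {k : ℕ} {A : Finset (Fin n)} (hA : A ∈ 𝒜⟦n, k⟧) (a : ℕ) :
    #((𝒜⟦n, k⟧).filter fun B => #(A ∩ B) = a) ≤ k.choose a * (n - k).choose (k - a) := by
  -- adapted from CliqueThresholdBounds.sum_erase_pow_inter_le
  have hAk : #A = k := (mem_powersetCard.1 hA).2
  have hinj : #((𝒜⟦n, k⟧).filter fun B => #(A ∩ B) = a) ≤
      #(powersetCard a A ×ˢ powersetCard (k - a) Aᶜ) := by
    refine card_le_card_of_injOn (fun B => (A ∩ B, B \ A)) (fun B hB => ?_) (fun B₁ _ B₂ _ h => ?_)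
    · rw [mem_coe, mem_filter] at hB
      obtain ⟨hB𝒜, hj'⟩ := hB
      have hBk : #B = k := (mem_powersetCard.1 hB𝒜).2
      simp only [mem_coe, mem_product, mem_powersetCard]
      refine ⟨⟨inter_subset_left, hj'⟩, fun v hv => mem_compl.2 (Finset.mem_sdiff.1 hv).2, ?_⟩
      have := card_sdiff_add_card_inter B A
      rw [inter_comm, hj', hBk] at this
      omega
    · simp only [Prod.mk.injEq] at h
      obtain ⟨h1, h2⟩ := h
      ext v
      by_cases hv : v ∈ A
      · have := Finset.ext_iff.1 h1 v
        simp only [mem_inter, hv, true_and] at this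
        exact this
      · have := Finset.ext_iff.1 h2 v
        simp only [Finset.mem_sdiff, hv, not_false_eq_true, and_true] at this
        exact this
  rwa [card_product, card_powersetCard, card_powersetCard, card_compl, Fintype.card_fin, hAk] at hinj

/-- A `k`-set `B ≠ A` meets `A` in fewer than `k` vertices. [folklore] -/
theorem ncc_card_inter_lt {k : ℕ} {A B : Finset (Fin n)} (hA : A ∈ 𝒜⟦n, k⟧) (hB : B ∈ 𝒜⟦n, k⟧)
    (hne : B ≠ A) : #(A ∩ B) < k := by
  -- adapted from RossmanMonotoneCliqueLemma23Proofs (`card_inter_lt_of_ne`)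
  have hAk := (mem_powersetCard.1 hA).2
  have hBk := (mem_powersetCard.1 hB).2
  by_contra hlt
  push Not at hlt
  have h1 : A ∩ B = A := eq_of_subset_of_card_le inter_subset_left (by omega)
  have h2 : A ⊆ B := by rw [← h1]; exact inter_subset_right
  exact hne (eq_of_subset_of_card_le h2 (by omega)).symm

end Moment

end Summit.PneNP.PneNP.Cruxes.ConstantBand.FlatPriorRelativeMinterms

end
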